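import Summits.AtomisticToContinuum.BoseEinsteinCondensation.Theorems.BECThomsonPrincipleFibreConductanceCageDefs
import Summits.AtomisticToContinuum.BoseEinsteinCondensation.Theorems.BECInsertionCorrectorCorrectorClosureNearMinimiserRigidityFrame
import Summits.AtomisticToContinuum.BoseEinsteinCondensation.Theorems.BECConjugateDominationHardCoreExtensionBoundedPositiveMinimiser
import Literature.MathematicalPhysics.QuantumManyBody.PeriodicGroundStateFeynmanKacProofs
import HarnessLib

/-!
# Route `BECThomsonPrinciple`, crux `FibreConductance` (stmt-AtomisticToContinuum-9480), line
# `tagged-path-harnack-cage-moments`: prerequisite (H1) of the lever `stub_shiftHarnack` —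
# the modulus of an exact minimiser IS the torus Feynman–Kac ground state

Helper file for the registered stub `stub_shiftHarnack : Goal.stub_shiftHarnack`
(`ShiftHarnack := LocalNumberExpMoments → BallHarnackMoment`, vocabulary file
`BECThomsonPrincipleFibreConductanceCageDefs.lean`). Step (1) of the paper proof of the lever reads
the exact zero-free minimiser `Φ` of the crux through the Feynman–Kac eigen-relation
`e^{-TH}|Φ| = e^{-E₀T}|Φ|`; this file proves that identification, used by every geometric line on
this crux ("uses (H1)"):

* `norm_minimiser_eq_of_isPeriodicGroundStateFK` — for `L > 0`, measurable `v` with bounded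
  periodisation `v^per ≤ C` and a continuous strictly positive Feynman–Kac ground state `Ψ₀`
  (`IsPeriodicGroundStateFK v L Ψ₀`), every EXACT minimiser `Φ : PeriodicTrialState N L`
  (`periodicEnergy v Φ = periodicGroundStateEnergy v N L`) has `|Φ| = Ψ₀` pointwise. Proof: the
  rigidity of near-minimisers (`rigidity_of_nearMinimiser`, line `healing-scale-kac-insertion`:
  Jensen's bound for `e^{-H}` against the two-level bound below the simple Perron–Frobenius
  eigenvalue) applies to `Φ` at EVERY tolerance `η > 0`: `‖Φ - αΨ₀‖²_cell ≤ η`, `1 - η ≤ |α|² ≤ 1`;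
  the reverse triangle inequality gives `∫_cell (|Φ| - Ψ₀)² ≤ 4η`, hence `= 0`, so `|Φ| = Ψ₀` a.e.
  on the cell, a.e. on `(ℝ³)^N` by periodicity, and everywhere by continuity.
* `minimiser_isPeriodicGroundStateFK`, `minimiser_norm_pos`, `norm_minimiser_eq_periodicFKGroundState`
  — in the crux's class (`v` repulsive finite-range with `v ≤ B`, `N = m + 1`, `L > 0`): the modulus
  of an exact minimiser is a witness of `IsPeriodicGroundStateFK v L`, is nowhere zero (exact
  minimisers are automatically zero-free), and equals the canonical `periodicFKGroundState`.
  Ingredients: bounded periodisation (`exists_periodizedPotential_le`) and the proved named fact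
  `PeriodicGroundStateFeynmanKac_holds`.

References: Reed–Simon IV Thm XIII.44 (simple positive ground state) [ReedSimonIV1978];
Chung–Zhao (1995) §3.2, Thm 3.27, Prop 3.29 [ChungZhao1995]; Glimm–Jaffe §3.3–3.4 [GlimmJaffeQP1987].
-/

noncomputable section

namespace Summit.AtomisticToContinuum.BoseEinsteinCondensation.Cruxes.FibreConductance.TaggedPathHarnack

open MeasureTheory Filter
open scoped ENNReal NNReal Topology
open Literature.MathematicalPhysics.QuantumManyBody.BoseGas
open Summit.AtomisticToContinuum.BoseEinsteinCondensation.Theorems.CorrectorClosure.HealingScaleKacInsertion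
  (rigidity_of_nearMinimiser)
open Summit.AtomisticToContinuum.BoseEinsteinCondensation.Cruxes.HardCoreExtension.ThirdLawCurrentFloor
  (exists_periodizedPotential_le)

variable {N : ℕ} {L : ℝ} {v : ℝ → ℝ≥0∞}

/-! ## The elementary inequality -/

/-- Reverse triangle inequality, squared: if `|α| ≤ 1`, `1 - η ≤ |α|²` and `p ≥ 0`, then
`(|z| - p)² ≤ 2|z - αp|² + 2ηp²` (`|z| - p = (|z| - |α|p) - (1 - |α|)p` and `(1 - |α|)² ≤ 1 - |α|²`).
[folklore] -/
theorem sq_norm_sub_le_of_near (z α : ℂ) {p η : ℝ} (hp : 0 ≤ p) (hα1 : ‖α‖ ≤ 1)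
    (hη : 1 - η ≤ ‖α‖ ^ 2) : (‖z‖ - p) ^ 2 ≤ 2 * ‖z - α * p‖ ^ 2 + 2 * η * p ^ 2 := by
  have h1 : |‖z‖ - ‖α‖ * p| ≤ ‖z - α * p‖ := by
    have := abs_norm_sub_norm_le z (α * p)
    rwa [norm_mul, Complex.norm_real, Real.norm_of_nonneg hp] at this
  have h2 : (1 - ‖α‖) ^ 2 ≤ η := by nlinarith [norm_nonneg α]
  have h3 : (‖z‖ - p) ^ 2 ≤ 2 * (‖z‖ - ‖α‖ * p) ^ 2 + 2 * ((1 - ‖α‖) * p) ^ 2 := by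
    nlinarith [sq_nonneg ((‖z‖ - ‖α‖ * p) + (1 - ‖α‖) * p)]
  have h4 : (‖z‖ - ‖α‖ * p) ^ 2 ≤ ‖z - α * p‖ ^ 2 := by
    rw [← sq_abs]; exact pow_le_pow_left₀ (abs_nonneg _) h1 2
  calc (‖z‖ - p) ^ 2 ≤ 2 * (‖z‖ - ‖α‖ * p) ^ 2 + 2 * ((1 - ‖α‖) * p) ^ 2 := h3
    _ ≤ 2 * ‖z - α * p‖ ^ 2 + 2 * η * p ^ 2 := by
        rw [mul_pow]; nlinarith [h4, h2, sq_nonneg p]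

/-! ## An exact minimiser is, in modulus, the Feynman–Kac ground state -/

/-- **The modulus of an exact minimiser is the Feynman–Kac ground state.** For `L > 0`, measurable
`v` with `v^per ≤ C`, and a continuous strictly positive witness `Ψ₀` of `IsPeriodicGroundStateFK v L`:
every periodic trial state `Φ` with `periodicEnergy v Φ = periodicGroundStateEnergy v N L` has
`|Φ(X)| = Ψ₀(X)` for all `X`. Rigidity of near-minimisers at every tolerance `η > 0`
(`‖Φ - αΨ₀‖²_cell ≤ η`, `1 - η ≤ |α|² ≤ 1`) and the reverse triangle inequality give
`∫_cell (|Φ| - Ψ₀)² ≤ 4η`, so `|Φ| = Ψ₀` a.e. on the cell, a.e. by periodicity, everywhere by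
continuity. [cite: ReedSimonIV1978, Thm XIII.44] -/
theorem norm_minimiser_eq_of_isPeriodicGroundStateFK (hv : Measurable v) (hL : 0 < L) {C : ℝ≥0}
    (hC : ∀ x, periodizedPotential v L x ≤ C) {Ψ₀ : Config N → ℝ}
    (hΨ : IsPeriodicGroundStateFK v L Ψ₀) (hcont : Continuous Ψ₀) (hpos : ∀ X, 0 < Ψ₀ X)
    (Φ : PeriodicTrialState N L) (hmin : periodicEnergy v Φ = periodicGroundStateEnergy v N L) :
    (fun X => ‖Φ.ψ X‖) = Ψ₀ := by
  have hΨm : Measurable Ψ₀ := hΨ.measurable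
  have hΦm : Measurable Φ.ψ := Φ.contDiff.continuous.measurable
  -- the `L²(cell)` defect of `|Φ|` from `Ψ₀`
  set D : ℝ≥0∞ := ∫⁻ X in cellN N L, ENNReal.ofReal ((‖Φ.ψ X‖ - Ψ₀ X) ^ 2) with hD
  -- Step 1: `D ≤ 4η` for every `η > 0`
  have hDle : ∀ η : ℝ, 0 < η → D ≤ ENNReal.ofReal (4 * η) := by
    intro η hη
    obtain ⟨δ, -, hrig⟩ := rigidity_of_nearMinimiser hv hL hC hΨ hcont hpos hη
    obtain ⟨α, hα1, hαη, hclose⟩ := hrig Φ (by rw [hmin]; exact le_self_add)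
    have hpt : ∀ X, ENNReal.ofReal ((‖Φ.ψ X‖ - Ψ₀ X) ^ 2) ≤
        2 * (‖Φ.ψ X - α * Ψ₀ X‖₊ : ℝ≥0∞) ^ 2 +
          ENNReal.ofReal (2 * η) * ENNReal.ofReal (Ψ₀ X) ^ 2 := by
      intro X
      have h := sq_norm_sub_le_of_near (Φ.ψ X) α (hΨ.nonneg X) hα1 hαη
      calc ENNReal.ofReal ((‖Φ.ψ X‖ - Ψ₀ X) ^ 2)
          ≤ ENNReal.ofReal (2 * ‖Φ.ψ X - α * Ψ₀ X‖ ^ 2 + 2 * η * Ψ₀ X ^ 2) :=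
            ENNReal.ofReal_le_ofReal h
        _ = _ := by
            rw [ENNReal.ofReal_add (by positivity) (by positivity), ENNReal.ofReal_mul zero_le_two,
              ENNReal.ofReal_ofNat, nnnorm_coe_sq_eq_ofReal, ENNReal.ofReal_mul (by positivity),
              ENNReal.ofReal_pow (hΨ.nonneg X)]
    have hmeas2 : Measurable fun X => ENNReal.ofReal (2 * η) * ENNReal.ofReal (Ψ₀ X) ^ 2 :=
      measurable_const.mul ((ENNReal.measurable_ofReal.comp hΨm).pow_const 2)
    calc D ≤ ∫⁻ X in cellN N L, (2 * (‖Φ.ψ X - α * Ψ₀ X‖₊ : ℝ≥0∞) ^ 2 +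
          ENNReal.ofReal (2 * η) * ENNReal.ofReal (Ψ₀ X) ^ 2) := lintegral_mono hpt
      _ = (2 * ∫⁻ X in cellN N L, (‖Φ.ψ X - α * Ψ₀ X‖₊ : ℝ≥0∞) ^ 2) +
          ENNReal.ofReal (2 * η) * ∫⁻ X in cellN N L, ENNReal.ofReal (Ψ₀ X) ^ 2 := by
          rw [lintegral_add_right _ hmeas2, lintegral_const_mul' _ _ ENNReal.ofNat_ne_top,
            lintegral_const_mul' _ _ ENNReal.ofReal_ne_top]
      _ ≤ 2 * ENNReal.ofReal η + ENNReal.ofReal (2 * η) * 1 :=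
          add_le_add (mul_le_mul_right hclose _) (mul_le_mul_right hΨ.norm_eq.le _)
      _ = ENNReal.ofReal (4 * η) := by
          rw [mul_one, ← ENNReal.ofReal_ofNat 2, ← ENNReal.ofReal_mul zero_le_two,
            ← ENNReal.ofReal_add (by positivity) (by positivity)]
          congr 1; ring
  -- Step 2: `D = 0`
  have hD0 : D = 0 := by
    refine le_antisymm (ENNReal.le_of_forall_pos_le_add fun ε hε _ => ?_) bot_le
    rw [zero_add]
    calc D ≤ ENNReal.ofReal (4 * ((ε : ℝ) / 4)) := hDle ((ε : ℝ) / 4) (by positivity)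
      _ = ε := by rw [mul_div_cancel₀ _ four_ne_zero, ENNReal.ofReal_coe_nnreal]
  -- Step 3: `|Φ| = Ψ₀` a.e. on the cell
  have hae : (fun X => ‖Φ.ψ X‖) =ᵐ[volume.restrict (cellN N L)] Ψ₀ := by
    have hmeas : Measurable fun X => ENNReal.ofReal ((‖Φ.ψ X‖ - Ψ₀ X) ^ 2) :=
      ENNReal.measurable_ofReal.comp ((hΦm.norm.sub hΨm).pow_const 2)
    have h0 := (lintegral_eq_zero_iff hmeas).1 hD0
    filter_upwards [h0] with X hX
    simp only [Pi.zero_apply, ENNReal.ofReal_eq_zero] at hX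
    have h2 : (‖Φ.ψ X‖ - Ψ₀ X) ^ 2 = 0 := le_antisymm hX (sq_nonneg _)
    exact sub_eq_zero.1 (pow_eq_zero_iff two_ne_zero |>.1 h2)
  -- Step 4: a.e. on `(ℝ³)^N` by periodicity, everywhere by continuity
  have hper : ∀ (X : Config N) (i : Fin N) (k : Fin 3),
      ‖Φ.ψ (X + Pi.single i (EuclideanSpace.single k L))‖ = ‖Φ.ψ X‖ := fun X i k => by
    rw [Φ.periodic]
  have hae' := ae_eq_of_periodic_of_ae_eq_cellN hL hper hΨ.periodic hae
  exact Measure.eq_of_ae_eq hae' (continuous_norm.comp Φ.contDiff.continuous) hcont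

/-! ## The crux's class: bounded repulsive finite-range potentials -/

/-- In the crux's class — `v` repulsive finite-range with `v ≤ B`, `N = m + 1 ≥ 1` bosons, `L > 0` —
the modulus of an EXACT minimiser `Φ` of the periodic energy equals the canonical Feynman–Kac ground
state `periodicFKGroundState v (m+1) L` pointwise (bounded periodisation
`exists_periodizedPotential_le`, the proved Feynman–Kac package `PeriodicGroundStateFeynmanKac_holds`,
and `norm_minimiser_eq_of_isPeriodicGroundStateFK`). [cite: ReedSimonIV1978, Thm XIII.44] -/
theorem norm_minimiser_eq_periodicFKGroundState (hv : IsRepulsiveFiniteRange v)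
    (hB : ∃ B : ℝ, ∀ r, v r ≤ ENNReal.ofReal B) {m : ℕ} (hL : 0 < L)
    (Φ : PeriodicTrialState (m + 1) L)
    (hmin : periodicEnergy v Φ = periodicGroundStateEnergy v (m + 1) L) :
    (fun X => ‖Φ.ψ X‖) = periodicFKGroundState v (m + 1) L := by
  obtain ⟨B, hB⟩ := hB
  obtain ⟨C, hC⟩ := exists_periodizedPotential_le hv ⟨ENNReal.ofReal B, ENNReal.ofReal_ne_top, hB⟩ hL
  obtain ⟨hΨ, hcont, hpos⟩ := PeriodicGroundStateFeynmanKac_holds.periodicFKGroundState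
    (N := m + 1) (Nat.succ_le_succ (Nat.zero_le m)) hL hv.1 ⟨C, hC⟩
  exact norm_minimiser_eq_of_isPeriodicGroundStateFK hv.1 hL hC hΨ hcont hpos Φ hmin

/-- **(H1) of the line `tagged-path-harnack-cage-moments`: the modulus of an exact minimiser is the
torus Feynman–Kac ground state.** For `v` repulsive finite-range with `v ≤ B`, `L > 0` and an exact
minimiser `Φ : PeriodicTrialState (m+1) L` (`periodicEnergy v Φ = periodicGroundStateEnergy v (m+1) L`),
`X ↦ |Φ(X)|` is a witness of `IsPeriodicGroundStateFK v L`: measurable, nonnegative, periodic, Bose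
symmetric, cell-normalised, with the pointwise eigen-relation `e^{-TH}|Φ| = e^{-E₀T}|Φ|` and the
ground-state projection `e^{E₀T}(e^{-TH}g)(X) → ⟨|Φ|, g⟩_cell |Φ(X)|`. (No zero-freeness hypothesis is
needed: it is a consequence, `minimiser_norm_pos`.) [cite: ReedSimonIV1978, Thm XIII.44] -/
theorem minimiser_isPeriodicGroundStateFK (hv : IsRepulsiveFiniteRange v)
    (hB : ∃ B : ℝ, ∀ r, v r ≤ ENNReal.ofReal B) {m : ℕ} (hL : 0 < L)
    (Φ : PeriodicTrialState (m + 1) L)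
    (hmin : periodicEnergy v Φ = periodicGroundStateEnergy v (m + 1) L) :
    IsPeriodicGroundStateFK v L (fun X => ‖Φ.ψ X‖) := by
  obtain ⟨B, hB⟩ := hB
  obtain ⟨C, hC⟩ := exists_periodizedPotential_le hv ⟨ENNReal.ofReal B, ENNReal.ofReal_ne_top, hB⟩ hL
  obtain ⟨hΨ, -, -⟩ := PeriodicGroundStateFeynmanKac_holds.periodicFKGroundState
    (N := m + 1) (Nat.succ_le_succ (Nat.zero_le m)) hL hv.1 ⟨C, hC⟩
  rwa [norm_minimiser_eq_periodicFKGroundState hv ⟨B, hB⟩ hL Φ hmin]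

/-- **Exact minimisers are zero-free**: in the crux's class, an exact minimiser `Φ` of the periodic
`(m+1)`-body energy has `|Φ(X)| > 0` everywhere (its modulus is the strictly positive Feynman–Kac
ground state). [cite: ReedSimonIV1978, Thm XIII.44] -/
theorem minimiser_norm_pos (hv : IsRepulsiveFiniteRange v)
    (hB : ∃ B : ℝ, ∀ r, v r ≤ ENNReal.ofReal B) {m : ℕ} (hL : 0 < L)
    (Φ : PeriodicTrialState (m + 1) L)
    (hmin : periodicEnergy v Φ = periodicGroundStateEnergy v (m + 1) L) (X : Config (m + 1)) :
    0 < ‖Φ.ψ X‖ := by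
  obtain ⟨B, hB⟩ := hB
  obtain ⟨C, hC⟩ := exists_periodizedPotential_le hv ⟨ENNReal.ofReal B, ENNReal.ofReal_ne_top, hB⟩ hL
  obtain ⟨-, -, hpos⟩ := PeriodicGroundStateFeynmanKac_holds.periodicFKGroundState
    (N := m + 1) (Nat.succ_le_succ (Nat.zero_le m)) hL hv.1 ⟨C, hC⟩
  have h := congrFun (norm_minimiser_eq_periodicFKGroundState hv ⟨B, hB⟩ hL Φ hmin) X
  rw [h]; exact hpos X

/-- The eigen-relation of an exact minimiser, read in the crux's variables: for `T ≥ 0` and all `X`,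
`E_X[e^{-∫₀ᵀ∑v^per} |Φ|(B_T)] = e^{-E₀T}|Φ(X)|` with `E₀ = periodicGroundStateEnergy v (m+1) L`
(field `eigen` of `minimiser_isPeriodicGroundStateFK`). [cite: ReedSimonIV1978, Thm XIII.44] -/
theorem periodicFKSemigroup_norm_minimiser (hv : IsRepulsiveFiniteRange v)
    (hB : ∃ B : ℝ, ∀ r, v r ≤ ENNReal.ofReal B) {m : ℕ} (hL : 0 < L)
    (Φ : PeriodicTrialState (m + 1) L)
    (hmin : periodicEnergy v Φ = periodicGroundStateEnergy v (m + 1) L) {T : ℝ} (hT : 0 ≤ T)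
    (X : Config (m + 1)) :
    periodicFKSemigroup v L T (fun Y => ENNReal.ofReal ‖Φ.ψ Y‖) X =
      ENNReal.ofReal (Real.exp (-((periodicGroundStateEnergy v (m + 1) L).toReal * T)) * ‖Φ.ψ X‖) :=
  (minimiser_isPeriodicGroundStateFK hv hB hL Φ hmin).eigen T hT X

end Summit.AtomisticToContinuum.BoseEinsteinCondensation.Cruxes.FibreConductance.TaggedPathHarnack

end
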